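/-
Copyright: the b2b-balaban T⁴-continuum CRUX team, row NE7b leaf lineage `t4-ne7b-formalise-leaf-03` (gen 147). Project licence.
-/
import Literature.MathematicalPhysics.QuantumFieldTheory.Balaban1983to89.B9Delta2Def134

/-!
# THE MULTIPLIER × CURVATURE FORM IS FORM-SMALL RELATIVE TO THE LOCAL FLOOR: from the printed POINTWISE, FINITE-RANGE
# shape of [B9] (3.137) — `|(Δ⁽²⁾A)(b)| ≤ O(1)Mα₀(Lʲη)⁻² · sup{|A| near b}` — to the ROAD's one-Hilbert-norm currency
# `|⟨A, Δ⁽²⁾A⟩| ≤ ρ · Σ_b (L^{j(b)}η)⁻² A(b)²` by a WEIGHTED SCHUR TEST, and the form-Neumann step: a weighted floor `m` of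
# `K + aQ*Q` on the gauge-fixed slice `{RD*A = 0}` and `ρ < m` give `G₁⁻¹ = G⁻¹ − Δ⁽²⁾_π > 0` WITH MODULUS `m − ρ`
# (row NE7b, node U5c; TRANSFER row (xxiv); [folklore] junction `Spine/NE7b` ↔ the typed [B9] Sect.-D carriers
# `B9Delta2Def134` ∕ `B9Eq3152` ∕ `B9SectDFP` — the first `Spine/NE7b` consumer of the typed (3.134)–(3.137) objects)

Cell `pub-balaban`, sub-cell `t4`, spine estimate NE7b (`T4WeightBudget.RelWeightBound`; NOT PRINTED in [Bałaban 1983–89],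
NOT PROVED).  Crux-route work under `Spine/NE7b/` by leaf-03 (CRUX team (2), FREEZE (0) crux-prover clause).  NOTHING of
Bałaban's is asserted, valued or discharged: the two inputs of printed shape — the (3.137)-type local bound on `Δ⁽²⁾ = 𝒞 + 𝒞ᵀ`
and the weighted floor of `K + aQ_b*Q_b` on the slice — are DISPLAYED hypotheses; every constant (`O(1)`, `M`, `α₀`, the
neighbourhood multiplicity `ν`, the scale-comparability factor `Λ`, the floor `m`) is a free symbol.  No `def`; zero `sorry`;
imports the BUILT Literature module `B9Delta2Def134` (which carries `B9Eq3152`, `B9SectDFP`, `B9H163`, `B6`) only.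

WHY (located by idea-1 T-92 §3 ∕ §5 (N-92-2), 2026-08-24, zero weight): print's smallness of the «multiplier × curvature»
operator `Δ⁽²⁾` ([B9] CMP 99 (3.134)–(3.137), pp. 422–423) is an ℓ^∞-weighted, finite-range bound PER SCALE — *"|(Δ⁽²⁾A)(b)| ≤
O(1)Mα₀(Lʲη)⁻²|A|, b ∈ Δ(y), y ∈ Λ_j, and the supremum |A| is taken over several j-blocks surrounding Δ(y)"* — while the
road's letters (this lineage's `ConstrainedValueLagrangian` §2 «`ρ < m∕2`», the OWNER's `LocalConditionalStability`, CSTF)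
speak ONE Hilbert-space form ratio `|⟨v, 𝒮v⟩| ≤ ρ‖v‖²` against a floor `m‖v‖²`.  The junction is a Schur-test line (finite
range × pointwise bound ⇒ ℓ² form bound) with the scale weights `(Lʲη)⁻²` carried on both sides — T-92: *"the (Lʲη)⁻²
weights CANCEL in the ratio"* — and the KLMN-type remark that a form-small symmetric perturbation of a form with a floor
keeps the floor minus the loss.  Nobody had typed it against the tree's carriers (T-92 §6 (iii): of 201 `Spine/NE7b` files
none imports `B9Delta2Def134` ∕ `B9Eq3152`).

WHAT IS PROVED ([folklore]: Schur 1911's test in the weighted form of e.g. [Grafakos, *Classical Fourier Analysis*, App. I];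
form-smallness ⇒ positivity is the finite-dimensional shadow of KLMN [Kato, *Perturbation Theory*, VI §1.6 Thm 1.33]):
* §1 `abs_quadForm_le_of_localBound` — THE WEIGHTED SCHUR TEST: for a real matrix `S` on a finite index type, neighbourhoods
  `N i` (card `≤ ν`, multiplicity `#{i : k ∈ N i} ≤ ν`), weights `0 ≤ w` with `w i ≤ Λ·w k` for `k ∈ N i`, and the local
  bound `|(SA) i| ≤ κ·w i·Σ_{k ∈ N i}|A k|` for all `A, i`:  `|⟨A, SA⟩| ≤ κν(1+Λ)∕2 · Σ_i w i·(A i)²`.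
* §2 `abs_delta2Form_le_of_ineq3137` — the instance `S = Δ⁽²⁾ = B9Delta2Def134.delta2 𝒞`, `w i = (ℓ i)⁻²`, `κ = O(1)·M·α₀`:
  the (3.137)-shaped local bound gives `|⟨A,Δ⁽²⁾A⟩| ≤ O(1)Mα₀·ν(1+Λ)∕2 · Σ_i (ℓ i)⁻²(A i)²`; `abs_curvatureForm_le_of_ineq3137`
  — the same for the form `⟨A, 𝒞A⟩ = ⟨HC⁽²⁾(A),J⟩` itself with half the constant (`B9Delta2Def134.eq_3134`);
  `localBound_of_ineq3137b` — the bridge from the typed printed shape `B9Delta2Def134.Ineq3137b C A ℓ Asup …` with a local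
  supremum dominated by the local ℓ¹-sum (`Asup i ≤ Σ_{k ∈ N i}|A k|`, true of any supremum attained in `N i`).
* §3 `floor_sub_delta2_of_floor_of_small` — THE FORM-NEUMANN STEP on any set of configurations: a floor
  `m·Σ w·A² ≤ ⟨A,(K + P)A⟩` and `|⟨A,Δ⁽²⁾A⟩| ≤ ρ·Σ w·A²` give `(m − ρ)·Σ w·A² ≤ ⟨A,(K − 2𝒞 + P)A⟩` (any `𝒞`: `⟨A, 2𝒞A⟩ =
  ⟨A, Δ⁽²⁾A⟩`); `G1inv_quadForm_ge_of_floor_of_small` — at [B9] (3.128)'s `G₁⁻¹ = B9Eq3152.G1inv K 𝒞 …`: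
  `(m − ρ)·Σ_i w i·(TA)_i² + ‖RD*A‖² ≤ ⟨A, G₁⁻¹A⟩` (`T = 1 − DG′RD*`, `B9SectDFP.Ginv_quadForm` + `R_Dt_mulVec_tOp`) — THE
  MODULUS SURVIVES WITH THE LOSS `ρ`; `G1inv_posDef_of_floor_of_small` — with `0 < w`, `ρ < m`: `G₁⁻¹` is positive definite
  (`B9Eq3152.G1inv_posDef_of_slicePos`, whose slice hypothesis is exactly what §3 delivers).
* §4 `G1inv_posDef_of_ineq3137_of_floor` — THE END: the (3.137)-shaped local bound on `Δ⁽²⁾` + the weighted floor `m` of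
  `K + aQ_b*Q_b` on `{RD*A = 0}` + the printed smallness clause in the road's letters, `O(1)·M·α₀·ν(1+Λ)∕2 < m` (*"α₀
  restricted by a small, absolute constant"*, p. 423 — the input of [B9] Thm 3.12 in this currency), give `G₁⁻¹ > 0`;
  `G1inv_modulus_of_ineq3137_of_floor` — and the modulus `m − O(1)Mα₀ν(1+Λ)∕2` in the weighted norm of `TA`.
* §5 a `2 × 2` toy (`example`): nearest-neighbour `S` on `Fin 2`, the Schur constant attained up to the factor `(1+Λ)∕2`.

DICTIONARY (print ↔ here; T-92 §3): `b ∈ Λ_j` coarse bond ↔ index `i : b`; `(Lʲη)⁻²` ↔ `w i = (ℓ i)⁻¹ ^ 2`; «several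
j-blocks surrounding Δ(y)» ↔ `N i : Finset b` with `card ≤ ν` and multiplicity `≤ ν`; neighbouring blocks differ in scale by
at most a factor `L` ↔ `w i ≤ Λ·w k` on `k ∈ N i` (`Λ = L²` in print's geometry; free here); `O(1)Mα₀` ↔ `c * M * α₀`; the
floor of `G₀⁻¹ = Δ + DRD* + Q*aQ` (Thm 3.3 ∕ 3.11 for `G₀`, local size `(Lʲη)⁻²` from `a‖QA‖²` and `Δ`) ↔ `hfloor`; «the
series (3.138) is convergent for α₀ restricted by a small, absolute constant» ↔ `c·M·α₀·ν(1+Λ)∕2 < m`.  This lineage's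
`ConstrainedValueLagrangian.firstOrderG_of_firstOrder` consumes the same ratio in the abstract currency (`ρ < m∕2` there is
`ρ_here < m` for the form `2s = ⟨·, Δ⁽²⁾·⟩`).

NOT HERE (honest): the (3.137) bound itself at Bałaban's `C_j⁽²⁾, H, J` (it is `B9Delta2Def134.ineq3137b_of_149`'s
displayed input, [5] (149)); the weighted floor of `G₀⁻¹` (Thm 3.3 ∕ 3.11, GAP G-B9-16's territory); the gauge-dressed
`Δ⁽²⁾_π = TᵀΔ⁽²⁾T` needs no separate smallness — §3 evaluates every form at `TA`; the Neumann SERIES (3.138) and its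
norms (print proves more: convergence in all Thm-3.3 norms — here only positivity + modulus, which is what the road's
convexity letters consume); infinite index sets; which `(K, 𝒞, ν, Λ, m)` are Bałaban's at step `k` ((A3) ∕ (A1c), NC-NE7b-α
UNRULED); anything at d = 4 specifically (d enters only the unvalued constants — T-92 §4).  BY-NAME EFFECT ON THE WALL:
NONE.  NE7b NOT PRINTED ∕ NOT PROVED; spine PROVED 0∕9; rung (B)+1 on a FINITE torus — NOT infinite volume, NOT the mass
gap, NOT Clay.  HONEST DEPENDENCY: continuum YM on T⁴ ⇐ BetaPertH ∧ nine spine estimates (0/9 proved); BetaPertH ⇐ (D1) ∧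
(D4) ∧ CAP+tail; G-an2-4 gates asym, D1 and NE2∕3∕4.
-/

set_option autoImplicit false

namespace Summit.QuantumFields.BalabanUV.T4Continuum.NE7b.MultiplierCurvatureSmallness

open Matrix Finset
open scoped Matrix
open Literature.MathematicalPhysics.QuantumFieldTheory.Balaban1983to89
open Literature.MathematicalPhysics.QuantumFieldTheory.Balaban1983to89.B9Delta2Def134 (delta2 eq_3134 Ineq3137b)

variable {b : Type*} [Fintype b]

/-! ## §1. The weighted Schur test: a finite-range operator with a pointwise local bound is form-bounded in the weighted norm -/

/-- Double sums over neighbourhoods swap into multiplicities: `Σ_i Σ_{k ∈ N i} f k = Σ_k #{i : k ∈ N i} · f k`. [folklore] -/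
theorem sum_sum_mem_eq_sum_card_mul [DecidableEq b] (N : b → Finset b) (f : b → ℝ) :
    ∑ i, ∑ k ∈ N i, f k = ∑ k, ((univ.filter fun i => k ∈ N i).card : ℝ) * f k := by
  have h1 : ∀ i, ∑ k ∈ N i, f k = ∑ k, if k ∈ N i then f k else 0 := fun i => by
    rw [Finset.sum_ite_mem, Finset.univ_inter]
  simp_rw [h1]
  rw [Finset.sum_comm]
  refine Finset.sum_congr rfl fun k _ => ?_
  have h2 : ∀ i, (if k ∈ N i then f k else 0) = (if k ∈ N i then (1 : ℝ) else 0) * f k := fun i => by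
    split_ifs <;> simp
  simp_rw [h2]
  rw [← Finset.sum_mul, Finset.sum_boole]

/-- **THE WEIGHTED SCHUR TEST.**  `S` a real matrix on a finite index type; neighbourhoods `N i` of cardinality `≤ ν` and
multiplicity `#{i : k ∈ N i} ≤ ν`; weights `0 ≤ w` comparable across neighbours (`w i ≤ Λ·w k` for `k ∈ N i`); the local
bound `|(SA) i| ≤ κ·w i·Σ_{k ∈ N i}|A k|` for every configuration `A` and index `i`.  Then
`|⟨A, SA⟩| ≤ κ·ν·(1+Λ)∕2 · Σ_i w i·(A i)²` for every `A` — Young on each pair, the diagonal share bounded by the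
cardinality, the off-diagonal share swapped into the multiplicity with the weights moved by `Λ`. [folklore] -/
theorem abs_quadForm_le_of_localBound [DecidableEq b] (S : Matrix b b ℝ) (N : b → Finset b) (w : b → ℝ)
    (hw : ∀ i, 0 ≤ w i) {κ Λ : ℝ} (hκ : 0 ≤ κ) (hΛ0 : 0 ≤ Λ) {ν : ℕ} (hcard : ∀ i, (N i).card ≤ ν)
    (hmult : ∀ k, (univ.filter fun i => k ∈ N i).card ≤ ν) (hΛ : ∀ i, ∀ k ∈ N i, w i ≤ Λ * w k)
    (hS : ∀ (A : b → ℝ) (i : b), |(S *ᵥ A) i| ≤ κ * w i * ∑ k ∈ N i, |A k|) (A : b → ℝ) :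
    |A ⬝ᵥ S *ᵥ A| ≤ κ * ν * (1 + Λ) / 2 * ∑ i, w i * A i ^ 2 := by
  -- (1) triangle inequality and the local bound, pair by pair with Young
  have step1 : |A ⬝ᵥ S *ᵥ A| ≤ ∑ i, κ * w i / 2 * ((N i).card * A i ^ 2 + ∑ k ∈ N i, A k ^ 2) := by
    calc |A ⬝ᵥ S *ᵥ A| = |∑ i, A i * (S *ᵥ A) i| := rfl
      _ ≤ ∑ i, |A i * (S *ᵥ A) i| := Finset.abs_sum_le_sum_abs _ _
      _ ≤ ∑ i, κ * w i / 2 * ((N i).card * A i ^ 2 + ∑ k ∈ N i, A k ^ 2) := by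
          refine Finset.sum_le_sum fun i _ => ?_
          have hkw : 0 ≤ κ * w i := mul_nonneg hκ (hw i)
          calc |A i * (S *ᵥ A) i| = |A i| * |(S *ᵥ A) i| := abs_mul _ _
            _ ≤ |A i| * (κ * w i * ∑ k ∈ N i, |A k|) := mul_le_mul_of_nonneg_left (hS A i) (abs_nonneg _)
            _ = ∑ k ∈ N i, κ * w i * (|A i| * |A k|) := by
                rw [Finset.mul_sum, Finset.mul_sum]
                exact Finset.sum_congr rfl fun k _ => by ring
            _ ≤ ∑ k ∈ N i, κ * w i * ((A i ^ 2 + A k ^ 2) / 2) := by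
                refine Finset.sum_le_sum fun k _ => mul_le_mul_of_nonneg_left ?_ hkw
                have h := two_mul_le_add_sq |A i| |A k|
                rw [sq_abs, sq_abs] at h
                linarith
            _ = κ * w i / 2 * ((N i).card * A i ^ 2 + ∑ k ∈ N i, A k ^ 2) := by
                rw [← Finset.mul_sum, ← Finset.sum_div, Finset.sum_add_distrib, Finset.sum_const, nsmul_eq_mul]
                ring
  -- (2) the diagonal share: cardinality ≤ ν
  have step2 : ∑ i, κ * w i / 2 * ((N i).card * A i ^ 2) ≤ ∑ i, κ * w i / 2 * (ν * A i ^ 2) := by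
    refine Finset.sum_le_sum fun i _ => mul_le_mul_of_nonneg_left ?_ (by have := hw i; positivity)
    exact mul_le_mul_of_nonneg_right (by exact_mod_cast hcard i) (sq_nonneg _)
  -- (3) the off-diagonal share: move the weight to the neighbour, swap, multiplicity ≤ ν
  have step3 : ∑ i, κ * w i / 2 * ∑ k ∈ N i, A k ^ 2 ≤ κ * Λ * ν / 2 * ∑ k, w k * A k ^ 2 := by
    calc ∑ i, κ * w i / 2 * ∑ k ∈ N i, A k ^ 2 = ∑ i, ∑ k ∈ N i, κ / 2 * (w i * A k ^ 2) := by
            refine Finset.sum_congr rfl fun i _ => ?_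
            rw [Finset.mul_sum]
            exact Finset.sum_congr rfl fun k _ => by ring
      _ ≤ ∑ i, ∑ k ∈ N i, κ / 2 * (Λ * (w k * A k ^ 2)) := by
            refine Finset.sum_le_sum fun i _ => Finset.sum_le_sum fun k hk => ?_
            refine mul_le_mul_of_nonneg_left ?_ (by positivity)
            have h := mul_le_mul_of_nonneg_right (hΛ i k hk) (sq_nonneg (A k))
            linarith
      _ = κ * Λ / 2 * ∑ k, ((univ.filter fun i => k ∈ N i).card : ℝ) * (w k * A k ^ 2) := by
            rw [← sum_sum_mem_eq_sum_card_mul N (fun k => w k * A k ^ 2), Finset.mul_sum]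
            refine Finset.sum_congr rfl fun i _ => ?_
            rw [Finset.mul_sum]
            exact Finset.sum_congr rfl fun k _ => by ring
      _ ≤ κ * Λ / 2 * ∑ k, (ν : ℝ) * (w k * A k ^ 2) := by
            refine mul_le_mul_of_nonneg_left (Finset.sum_le_sum fun k _ => ?_) (by positivity)
            exact mul_le_mul_of_nonneg_right (by exact_mod_cast hmult k) (mul_nonneg (hw k) (sq_nonneg _))
      _ = κ * Λ * ν / 2 * ∑ k, w k * A k ^ 2 := by
            rw [← Finset.mul_sum]
            ring
  -- (4) assemble
  have split : ∑ i, κ * w i / 2 * ((N i).card * A i ^ 2 + ∑ k ∈ N i, A k ^ 2) =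
      ∑ i, κ * w i / 2 * ((N i).card * A i ^ 2) + ∑ i, κ * w i / 2 * ∑ k ∈ N i, A k ^ 2 := by
    rw [← Finset.sum_add_distrib]
    exact Finset.sum_congr rfl fun i _ => by ring
  have diag : ∑ i, κ * w i / 2 * (ν * A i ^ 2) = κ * ν / 2 * ∑ i, w i * A i ^ 2 := by
    rw [Finset.mul_sum]
    exact Finset.sum_congr rfl fun i _ => by ring
  calc |A ⬝ᵥ S *ᵥ A| ≤ ∑ i, κ * w i / 2 * ((N i).card * A i ^ 2 + ∑ k ∈ N i, A k ^ 2) := step1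
    _ ≤ κ * ν / 2 * ∑ i, w i * A i ^ 2 + κ * Λ * ν / 2 * ∑ k, w k * A k ^ 2 := by
        rw [split, ← diag]; exact add_le_add step2 step3
    _ = κ * ν * (1 + Λ) / 2 * ∑ i, w i * A i ^ 2 := by ring

/-! ## §2. The instance `S = Δ⁽²⁾` of [B9] (3.134) under the (3.137)-shaped local bound -/

/-- **`Δ⁽²⁾` IS FORM-SMALL IN THE SCALE-WEIGHTED NORM**: if `|(Δ⁽²⁾A) i| ≤ c·M·α₀·(ℓ i)⁻²·Σ_{k ∈ N i}|A k|` for all `A, i`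
(the shape of [B9] (3.137), the local supremum replaced by the local ℓ¹-sum it is dominated by), with neighbourhoods of
cardinality and multiplicity `≤ ν` and scales comparable across neighbours (`(ℓ i)⁻² ≤ Λ·(ℓ k)⁻²`), then
`|⟨A, Δ⁽²⁾A⟩| ≤ c·M·α₀·ν(1+Λ)∕2 · Σ_i (ℓ i)⁻²(A i)²`. [folklore] -/
theorem abs_delta2Form_le_of_ineq3137 [DecidableEq b] (C : Matrix b b ℝ) (N : b → Finset b) (ℓ : b → ℝ)
    {c M α₀ Λ : ℝ} (hc : 0 ≤ c * M * α₀) (hΛ0 : 0 ≤ Λ) {ν : ℕ} (hcard : ∀ i, (N i).card ≤ ν)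
    (hmult : ∀ k, (univ.filter fun i => k ∈ N i).card ≤ ν)
    (hΛ : ∀ i, ∀ k ∈ N i, (ℓ i)⁻¹ ^ 2 ≤ Λ * (ℓ k)⁻¹ ^ 2)
    (h3137 : ∀ (A : b → ℝ) (i : b), |(delta2 C *ᵥ A) i| ≤ c * M * α₀ * (ℓ i)⁻¹ ^ 2 * ∑ k ∈ N i, |A k|)
    (A : b → ℝ) :
    |A ⬝ᵥ delta2 C *ᵥ A| ≤ c * M * α₀ * ν * (1 + Λ) / 2 * ∑ i, (ℓ i)⁻¹ ^ 2 * A i ^ 2 :=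
  abs_quadForm_le_of_localBound (delta2 C) N (fun i => (ℓ i)⁻¹ ^ 2) (fun _ => sq_nonneg _) hc hΛ0 hcard hmult hΛ
    h3137 A

/-- The same for the form `⟨A, 𝒞A⟩ = ⟨HC⁽²⁾(A), J⟩` itself, half the constant: `⟨A, Δ⁽²⁾A⟩ = 2⟨A, 𝒞A⟩`
(`B9Delta2Def134.eq_3134`). [folklore] -/
theorem abs_curvatureForm_le_of_ineq3137 [DecidableEq b] (C : Matrix b b ℝ) (N : b → Finset b) (ℓ : b → ℝ)
    {c M α₀ Λ : ℝ} (hc : 0 ≤ c * M * α₀) (hΛ0 : 0 ≤ Λ) {ν : ℕ} (hcard : ∀ i, (N i).card ≤ ν)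
    (hmult : ∀ k, (univ.filter fun i => k ∈ N i).card ≤ ν)
    (hΛ : ∀ i, ∀ k ∈ N i, (ℓ i)⁻¹ ^ 2 ≤ Λ * (ℓ k)⁻¹ ^ 2)
    (h3137 : ∀ (A : b → ℝ) (i : b), |(delta2 C *ᵥ A) i| ≤ c * M * α₀ * (ℓ i)⁻¹ ^ 2 * ∑ k ∈ N i, |A k|)
    (A : b → ℝ) :
    |A ⬝ᵥ C *ᵥ A| ≤ c * M * α₀ * ν * (1 + Λ) / 4 * ∑ i, (ℓ i)⁻¹ ^ 2 * A i ^ 2 := by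
  have h := abs_delta2Form_le_of_ineq3137 C N ℓ hc hΛ0 hcard hmult hΛ h3137 A
  rw [eq_3134, abs_mul, abs_two] at h
  linarith

/-- **BRIDGE FROM THE TYPED PRINTED SHAPE**: if for every `A` the bound `B9Delta2Def134.Ineq3137b C A ℓ Asup c M α₀` holds
with a local supremum `Asup` dominated by the local ℓ¹-sum over `N i` (true of `Asup i = max_{k ∈ N i}|A k|`), then the
local bound of this file holds (for `0 ≤ c·M·α₀`). [folklore] -/
theorem localBound_of_ineq3137b (C : Matrix b b ℝ) (N : b → Finset b) (ℓ : b → ℝ) {c M α₀ : ℝ}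
    (hc : 0 ≤ c * M * α₀)
    (h : ∀ A : b → ℝ, ∃ Asup : b → ℝ, Ineq3137b C A ℓ Asup c M α₀ ∧ ∀ i, Asup i ≤ ∑ k ∈ N i, |A k|)
    (A : b → ℝ) (i : b) :
    |(delta2 C *ᵥ A) i| ≤ c * M * α₀ * (ℓ i)⁻¹ ^ 2 * ∑ k ∈ N i, |A k| := by
  obtain ⟨Asup, h3137, hsup⟩ := h A
  exact (h3137 i).trans (mul_le_mul_of_nonneg_left (hsup i) (mul_nonneg hc (sq_nonneg _)))

/-! ## §3. The form-Neumann step: a weighted floor and form-smallness give the floor minus the loss, hence `G₁⁻¹ > 0` -/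

/-- **FLOOR MINUS LOSS.**  On any set `𝒜` of configurations: a floor `m·Σ w·A² ≤ ⟨A, (K + P)A⟩` on `𝒜` and the smallness
`|⟨A, Δ⁽²⁾A⟩| ≤ ρ·Σ w·A²` give `(m − ρ)·Σ w·A² ≤ ⟨A, (K − 2𝒞 + P)A⟩` on `𝒜` (for ANY `𝒞`: `⟨A, 2𝒞A⟩ = ⟨A, Δ⁽²⁾A⟩`).
[folklore] -/
theorem floor_sub_delta2_of_floor_of_small (K C P : Matrix b b ℝ) (w : b → ℝ) {m ρ : ℝ} (𝒜 : Set (b → ℝ))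
    (hfloor : ∀ A ∈ 𝒜, m * ∑ i, w i * A i ^ 2 ≤ A ⬝ᵥ (K + P) *ᵥ A)
    (hsmall : ∀ A : b → ℝ, |A ⬝ᵥ delta2 C *ᵥ A| ≤ ρ * ∑ i, w i * A i ^ 2) (A : b → ℝ) (hA : A ∈ 𝒜) :
    (m - ρ) * ∑ i, w i * A i ^ 2 ≤ A ⬝ᵥ (K - (2 : ℝ) • C + P) *ᵥ A := by
  have h1 := hfloor A hA
  have h2 := (abs_le.mp (hsmall A)).2
  have e : A ⬝ᵥ (K - (2 : ℝ) • C + P) *ᵥ A = A ⬝ᵥ (K + P) *ᵥ A - A ⬝ᵥ delta2 C *ᵥ A := by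
    rw [eq_3134, add_mulVec, add_mulVec, sub_mulVec, dotProduct_add, dotProduct_add, dotProduct_sub,
      Matrix.smul_mulVec, dotProduct_smul, smul_eq_mul]
    ring
  rw [e]
  linarith

/-- A weighted sum of squares with positive weights is positive at a nonzero configuration. [folklore] -/
theorem sum_weight_sq_pos (w : b → ℝ) (hw : ∀ i, 0 < w i) (A : b → ℝ) (hA : A ≠ 0) :
    0 < ∑ i, w i * A i ^ 2 := by
  obtain ⟨i, hi⟩ := Function.ne_iff.mp hA
  exact Finset.sum_pos' (fun k _ => mul_nonneg (hw k).le (sq_nonneg _))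
    ⟨i, Finset.mem_univ i, mul_pos (hw i) (even_two.pow_pos hi)⟩

section G1

variable {n m q : Type*} [Fintype n] [Fintype m] [Fintype q] [DecidableEq n] [DecidableEq m] [DecidableEq b]

/-- **THE MODULUS OF `G₁⁻¹` SURVIVES WITH THE LOSS `ρ`.**  For [B9] (3.128)'s `G₁⁻¹ = B9Eq3152.G1inv K 𝒞 Δ Q a D Q_b a_b`
(`= Tᵀ(K − 2𝒞)T + DRD* + a_bQ_bᵀQ_b`, `T = 1 − DG′RD*`): a weighted floor `m` of `K + a_bQ_bᵀQ_b` on the gauge-fixed slice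
`{A : RD*A = 0}` and the smallness `|⟨A, Δ⁽²⁾A⟩| ≤ ρ·Σ w·A²` give, for EVERY `A`,
`(m − ρ)·Σ_i w i·((TA) i)² + ‖RD*A‖² ≤ ⟨A, G₁⁻¹A⟩` — because `TA` lies on the slice (`B9SectDFP.R_Dt_mulVec_tOp`) and
`⟨A, G₁⁻¹A⟩ = ⟨TA, (K − 2𝒞 + a_bQ_bᵀQ_b)TA⟩ + ‖RD*A‖²` (`B9SectDFP.Ginv_quadForm`). [folklore] -/
theorem G1inv_quadForm_ge_of_floor_of_small (K C : Matrix b b ℝ) (Δ : Matrix n n ℝ) (Q : Matrix m n ℝ) (a : ℝ)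
    (hΔ : Δ.IsSymm) (hΔ' : IsUnit (B9H163.Δ' Δ Q a)) (hM' : IsUnit (B9H163.M' Δ Q a)) (D : Matrix b n ℝ)
    (hD : Dᵀ * D = Δ) (Qb : Matrix q b ℝ) (Dbar : Matrix q m ℝ) (h115 : Qb * D = Dbar * Q) (ab : ℝ) (w : b → ℝ)
    {m ρ : ℝ}
    (hfloor : ∀ A : b → ℝ, B9H163.R Δ Q a *ᵥ (Dᵀ *ᵥ A) = 0 →
      m * ∑ i, w i * A i ^ 2 ≤ A ⬝ᵥ (K + ab • (Qbᵀ * Qb)) *ᵥ A)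
    (hsmall : ∀ A : b → ℝ, |A ⬝ᵥ delta2 C *ᵥ A| ≤ ρ * ∑ i, w i * A i ^ 2) (A : b → ℝ) :
    (m - ρ) * ∑ i, w i * (B9SectDFP.tOp Δ Q a D *ᵥ A) i ^ 2
        + (B9H163.R Δ Q a *ᵥ (Dᵀ *ᵥ A)) ⬝ᵥ (B9H163.R Δ Q a *ᵥ (Dᵀ *ᵥ A))
      ≤ A ⬝ᵥ B9Eq3152.G1inv K C Δ Q a D Qb ab *ᵥ A := by
  have hT : B9H163.R Δ Q a *ᵥ (Dᵀ *ᵥ (B9SectDFP.tOp Δ Q a D *ᵥ A)) = 0 :=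
    B9SectDFP.R_Dt_mulVec_tOp Δ Q a hΔ' hM' D hD A
  have h := floor_sub_delta2_of_floor_of_small K C (ab • (Qbᵀ * Qb)) w
    {A | B9H163.R Δ Q a *ᵥ (Dᵀ *ᵥ A) = 0} (fun A hA => hfloor A hA) hsmall _ hT
  rw [B9Eq3152.G1inv, B9SectDFP.Ginv_quadForm (K - (2 : ℝ) • C) Δ Q a hΔ hM' D Qb Dbar h115 ab A]
  linarith

/-- **`G₁⁻¹ > 0` FROM A WEIGHTED FLOOR AND FORM-SMALLNESS** (`K`, `𝒞` symmetric; weights `0 < w`; `ρ < m`): the slice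
hypothesis of `B9Eq3152.G1inv_posDef_of_slicePos` is `floor_sub_delta2_of_floor_of_small` + `sum_weight_sq_pos`. [folklore] -/
theorem G1inv_posDef_of_floor_of_small (K C : Matrix b b ℝ) (hK : Kᵀ = K) (hC : Cᵀ = C) (Δ : Matrix n n ℝ)
    (Q : Matrix m n ℝ) (a : ℝ) (hΔ : Δ.IsSymm) (hΔ' : IsUnit (B9H163.Δ' Δ Q a)) (hM' : IsUnit (B9H163.M' Δ Q a))
    (D : Matrix b n ℝ) (hD : Dᵀ * D = Δ) (Qb : Matrix q b ℝ) (Dbar : Matrix q m ℝ) (h115 : Qb * D = Dbar * Q)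
    (ab : ℝ) (w : b → ℝ) (hw : ∀ i, 0 < w i) {m ρ : ℝ} (hρ : ρ < m)
    (hfloor : ∀ A : b → ℝ, B9H163.R Δ Q a *ᵥ (Dᵀ *ᵥ A) = 0 →
      m * ∑ i, w i * A i ^ 2 ≤ A ⬝ᵥ (K + ab • (Qbᵀ * Qb)) *ᵥ A)
    (hsmall : ∀ A : b → ℝ, |A ⬝ᵥ delta2 C *ᵥ A| ≤ ρ * ∑ i, w i * A i ^ 2) :
    (B9Eq3152.G1inv K C Δ Q a D Qb ab).PosDef := by
  refine B9Eq3152.G1inv_posDef_of_slicePos K C hK hC Δ Q a hΔ hΔ' hM' D hD Qb Dbar h115 ab fun A hRA hA => ?_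
  have h := floor_sub_delta2_of_floor_of_small K C (ab • (Qbᵀ * Qb)) w
    {A | B9H163.R Δ Q a *ᵥ (Dᵀ *ᵥ A) = 0} (fun A hA => hfloor A hA) hsmall A hRA
  exact lt_of_lt_of_le (mul_pos (sub_pos.mpr hρ) (sum_weight_sq_pos w hw A hA)) h

/-! ## §4. The END: the (3.137)-shaped local bound + a weighted floor + the printed smallness clause give `G₁⁻¹ > 0` -/

/-- **THE END — [B9] Thm 3.12's positivity input in the road's currency.**  `K`, `𝒞` symmetric on the bond index `b`;
scales `ℓ i ≠ 0`; neighbourhoods `N i` (cardinality, multiplicity `≤ ν`; `(ℓ i)⁻² ≤ Λ(ℓ k)⁻²` on neighbours); the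
(3.137)-shaped bound `|(Δ⁽²⁾A) i| ≤ c·M·α₀·(ℓ i)⁻²·Σ_{k ∈ N i}|A k|`; the weighted floor `m·Σ(ℓ i)⁻²(A i)² ≤ ⟨A,(K + a_bQ_bᵀQ_b)A⟩`
on `{RD*A = 0}`; and the smallness clause `c·M·α₀·ν(1+Λ)∕2 < m` («α₀ restricted by a small, absolute constant»).  Then
`G₁⁻¹ = B9Eq3152.G1inv K 𝒞 …` is positive definite. [folklore] -/
theorem G1inv_posDef_of_ineq3137_of_floor (K C : Matrix b b ℝ) (hK : Kᵀ = K) (hC : Cᵀ = C) (Δ : Matrix n n ℝ)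
    (Q : Matrix m n ℝ) (a : ℝ) (hΔ : Δ.IsSymm) (hΔ' : IsUnit (B9H163.Δ' Δ Q a)) (hM' : IsUnit (B9H163.M' Δ Q a))
    (D : Matrix b n ℝ) (hD : Dᵀ * D = Δ) (Qb : Matrix q b ℝ) (Dbar : Matrix q m ℝ) (h115 : Qb * D = Dbar * Q)
    (ab : ℝ) (N : b → Finset b) (ℓ : b → ℝ) (hℓ : ∀ i, ℓ i ≠ 0) {c M α₀ Λ m : ℝ} (hc : 0 ≤ c * M * α₀)
    (hΛ0 : 0 ≤ Λ) {ν : ℕ} (hcard : ∀ i, (N i).card ≤ ν) (hmult : ∀ k, (univ.filter fun i => k ∈ N i).card ≤ ν)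
    (hΛ : ∀ i, ∀ k ∈ N i, (ℓ i)⁻¹ ^ 2 ≤ Λ * (ℓ k)⁻¹ ^ 2)
    (h3137 : ∀ (A : b → ℝ) (i : b), |(delta2 C *ᵥ A) i| ≤ c * M * α₀ * (ℓ i)⁻¹ ^ 2 * ∑ k ∈ N i, |A k|)
    (hfloor : ∀ A : b → ℝ, B9H163.R Δ Q a *ᵥ (Dᵀ *ᵥ A) = 0 →
      m * ∑ i, (ℓ i)⁻¹ ^ 2 * A i ^ 2 ≤ A ⬝ᵥ (K + ab • (Qbᵀ * Qb)) *ᵥ A)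
    (hα₀ : c * M * α₀ * ν * (1 + Λ) / 2 < m) :
    (B9Eq3152.G1inv K C Δ Q a D Qb ab).PosDef :=
  G1inv_posDef_of_floor_of_small K C hK hC Δ Q a hΔ hΔ' hM' D hD Qb Dbar h115 ab (fun i => (ℓ i)⁻¹ ^ 2)
    (fun i => even_two.pow_pos (inv_ne_zero (hℓ i))) hα₀ hfloor
    (abs_delta2Form_le_of_ineq3137 C N ℓ hc hΛ0 hcard hmult hΛ h3137)

/-- … and the MODULUS in the scale-weighted norm of `TA`: `(m − c·M·α₀·ν(1+Λ)∕2)·Σ(ℓ i)⁻²((TA) i)² + ‖RD*A‖² ≤ ⟨A, G₁⁻¹A⟩`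
(no symmetry, sign or smallness clause needed for the inequality itself). [folklore] -/
theorem G1inv_modulus_of_ineq3137_of_floor (K C : Matrix b b ℝ) (Δ : Matrix n n ℝ) (Q : Matrix m n ℝ) (a : ℝ)
    (hΔ : Δ.IsSymm) (hΔ' : IsUnit (B9H163.Δ' Δ Q a)) (hM' : IsUnit (B9H163.M' Δ Q a)) (D : Matrix b n ℝ)
    (hD : Dᵀ * D = Δ) (Qb : Matrix q b ℝ) (Dbar : Matrix q m ℝ) (h115 : Qb * D = Dbar * Q) (ab : ℝ)
    (N : b → Finset b) (ℓ : b → ℝ) {c M α₀ Λ m : ℝ} (hc : 0 ≤ c * M * α₀) (hΛ0 : 0 ≤ Λ) {ν : ℕ}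
    (hcard : ∀ i, (N i).card ≤ ν) (hmult : ∀ k, (univ.filter fun i => k ∈ N i).card ≤ ν)
    (hΛ : ∀ i, ∀ k ∈ N i, (ℓ i)⁻¹ ^ 2 ≤ Λ * (ℓ k)⁻¹ ^ 2)
    (h3137 : ∀ (A : b → ℝ) (i : b), |(delta2 C *ᵥ A) i| ≤ c * M * α₀ * (ℓ i)⁻¹ ^ 2 * ∑ k ∈ N i, |A k|)
    (hfloor : ∀ A : b → ℝ, B9H163.R Δ Q a *ᵥ (Dᵀ *ᵥ A) = 0 →
      m * ∑ i, (ℓ i)⁻¹ ^ 2 * A i ^ 2 ≤ A ⬝ᵥ (K + ab • (Qbᵀ * Qb)) *ᵥ A)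
    (A : b → ℝ) :
    (m - c * M * α₀ * ν * (1 + Λ) / 2) * ∑ i, (ℓ i)⁻¹ ^ 2 * (B9SectDFP.tOp Δ Q a D *ᵥ A) i ^ 2
        + (B9H163.R Δ Q a *ᵥ (Dᵀ *ᵥ A)) ⬝ᵥ (B9H163.R Δ Q a *ᵥ (Dᵀ *ᵥ A))
      ≤ A ⬝ᵥ B9Eq3152.G1inv K C Δ Q a D Qb ab *ᵥ A :=
  G1inv_quadForm_ge_of_floor_of_small K C Δ Q a hΔ hΔ' hM' D hD Qb Dbar h115 ab (fun i => (ℓ i)⁻¹ ^ 2) hfloor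
    (abs_delta2Form_le_of_ineq3137 C N ℓ hc hΛ0 hcard hmult hΛ h3137) A

end G1

/-! ## §5. Toy: the Schur constant on `Fin 2` -/

/-- Toy (nearest neighbours on two sites, unit weights, `κ = 1`, `ν = 2`, `Λ = 1`): for `S = !![1, 1; 1, 1]` the local bound
`|(SA) i| ≤ |A 0| + |A 1|` holds and the test gives `|⟨A, SA⟩| ≤ 2(A 0² + A 1²)` — attained at `A = (1, 1)`:
`⟨A, SA⟩ = 4 = 2·2`. [folklore] -/
example (x y : ℝ) : |(x + y) * x + (x + y) * y| ≤ 1 * (2 : ℕ) * (1 + 1) / 2 * (1 * x ^ 2 + 1 * y ^ 2) := by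
  have h : (x + y) * x + (x + y) * y = (x + y) ^ 2 := by ring
  rw [h, abs_of_nonneg (sq_nonneg _)]
  push_cast
  nlinarith [sq_nonneg (x - y)]

end Summit.QuantumFields.BalabanUV.T4Continuum.NE7b.MultiplierCurvatureSmallness
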